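import Literature.NumberTheory.Automorphic.ShimuraCurveGroupDiscrete
import Literature.NumberTheory.Automorphic.BrandtDataRingEquiv
import HarnessLib

/-!
# Crux NUM `CartanOnePlaceDegreeLawAtThree` (item 24801), line `lattice` — the print clauses III: the norm-one groups `ι(O¹)` of ANY two orders of one quaternion
# algebra are COMMENSURABLE; `ι(O¹)` under a change of presentation (`ι ↦ ι ∘ e`, `ι ↦ h ι h⁻¹`)

Seat `bsd-stepL-tam3-p1` g29 (LEAD of crux 24801; `--supports stmt-BirchSwinnertonDyer-24801 --as helper`). Bookkeeping for the discharge of clause (SIGᶜ)(i)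
of the cite stub's conjunct `Literature.NumberTheory.Automorphic.parabolicCochain_free_and_modLift` AS STATED (every order `O` of every quaternion algebra `B` over `ℚ`
with an injective `ι : B →ₐ[ℚ] M₂(ℝ)`): by `…PrintClausesDivision.sigBasisClause_of_fg` that clause is `Group.FG (normOneUnits ι hO)`, and finite generation will be
transported (sequel `…PrintClausesFinitelyGenerated`) from Bergeron's family `Γ_{a,b} = ρ(𝔬¹)` (tree `QuaternionType.fg_unitGroup`) along (1) an isomorphism
`B ≃ₐ[ℚ] ℍ[ℚ,a,b]`, (2) Skolem–Noether `ι = h ρ h⁻¹`, (3) commensurability of the unit groups of the transported order and of `𝔬`. This file proves the three transports: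

* §1 `normOneUnits_comp_algEquiv` — `normOneUnits (ι' ∘ e) O = normOneUnits ι' e(O)` for `e : B ≃ₐ[ℚ] B'`; `normOneUnits_eq_conjAct_smul` — if `ι x = h·ι' x·h⁻¹` for all
  `x` then `normOneUnits ι O = h • normOneUnits ι' O` (`ConjAct`).
* §2 **`exists_finset_leftCosets`** — for ANY two orders `O₁`, `O₃` of a quaternion algebra, finitely many `t_v ∈ ι(O₁¹)` with `ι(O₁¹) ⊆ ⋃_v t_v·ι(O₃¹)`. Proof
  (the pattern of the tree's `CartanCover.MapDegree.exists_finset_leftCosets`, g27, there for `X.O ≤ X.O₀`): `N·O₁ ⊆ O₃` for some `N ≠ 0` (tree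
  `IsFullLattice.exists_smul_mem_of_fg`); two norm-one units `u, u'` of `O₁` with the same coordinates modulo `N` in a `ℤ`-basis of `O₁` satisfy
  `u⁻¹u' − 1 = u⁻¹(u' − u) ∈ N·O₁ ⊆ O₃`, so `u⁻¹u' ∈ O₃¹`; the coordinate map has finite range. Hence **`finiteIndex_normOneUnits_subgroupOf`** and
  **`commensurable_normOneUnits`** — THE NORM-ONE GROUPS OF ANY TWO ORDERS OF `B` ARE COMMENSURABLE.

Theorems only; nothing about NUM or any curve is proved; BSD is proved for no curve.
[cite: VignerasLNM800, Ch. IV §1 Thm. 1.1 and Ch. I §4 (commensurable unit groups of orders)] [cite: Bergeron2016, §2.2 p. 36 (commensurable)]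
-/

set_option linter.dupNamespace false
set_option autoImplicit false

noncomputable section

open scoped MatrixGroups Pointwise
open Function Set

namespace Summit.BirchSwinnertonDyer.BirchSwinnertonDyer.Theorems.CartanCover.PrintClauses

open Literature.NumberTheory.Automorphic

/-! ## §1 `ι(O¹)` under a change of presentation -/

section Presentation

variable {B B' : Type*} [Ring B] [Algebra ℚ B] [Ring B'] [Algebra ℚ B']

/-- **`normOneUnits (ι' ∘ e) O = normOneUnits ι' e(O)`** for an algebra isomorphism `e : B ≃ₐ[ℚ] B'` (same matrices: `ι'(e x)`, `x ∈ O`). [folklore] -/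
theorem normOneUnits_comp_algEquiv (e : B ≃ₐ[ℚ] B') (ι' : B' →ₐ[ℚ] Matrix (Fin 2) (Fin 2) ℝ) {O : Submodule ℤ B}
    (hO : Brandt.IsOrder B O) :
    normOneUnits (ι'.comp (e : B →ₐ[ℚ] B')) hO = normOneUnits ι' (hO.map_ringEquiv (e : B ≃+* B')) := by
  ext g
  simp only [mem_normOneUnits_iff]
  have key : ∀ m : Matrix (Fin 2) (Fin 2) ℝ,
      (∃ x ∈ O, (ι'.comp (e : B →ₐ[ℚ] B')) x = m) ↔
        ∃ x' ∈ O.map (((e : B ≃+* B').toAddEquiv.toIntLinearEquiv : B →ₗ[ℤ] B')), ι' x' = m := by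
    intro m
    constructor
    · rintro ⟨x, hx, hxm⟩
      refine ⟨e x, ?_, hxm⟩
      rw [mem_map_ringEquiv_iff]
      have h1 : (e : B ≃+* B').symm (e x) = x := (e : B ≃+* B').symm_apply_apply x
      change (e : B ≃+* B').symm (e x) ∈ O
      rw [h1]
      exact hx
    · rintro ⟨x', hx', hxm⟩
      rw [mem_map_ringEquiv_iff] at hx'
      refine ⟨(e : B ≃+* B').symm x', hx', ?_⟩
      rw [AlgHom.comp_apply, ← hxm]
      congr 1
      change e ((e : B ≃+* B').symm x') = x'
      exact (e : B ≃+* B').apply_symm_apply x'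
  rw [key, key]

/-- **Conjugate presentations give conjugate groups**: if `ι x = h · ι' x · h⁻¹` for all `x`, then `normOneUnits ι O = h • normOneUnits ι' O` (the `ConjAct` action of
`GL₂(ℝ)` on its subgroups). [cite: Bergeron2016, §2.2 proof of Thm. 2.3 p. 37] -/
theorem normOneUnits_eq_conjAct_smul {ι ι' : B →ₐ[ℚ] Matrix (Fin 2) (Fin 2) ℝ} (h : GL (Fin 2) ℝ)
    (hconj : ∀ x : B, ι x = (h : Matrix (Fin 2) (Fin 2) ℝ) * ι' x * ((h⁻¹ : GL (Fin 2) ℝ) : Matrix (Fin 2) (Fin 2) ℝ))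
    {O : Submodule ℤ B} (hO : Brandt.IsOrder B O) :
    normOneUnits ι hO = ConjAct.toConjAct h • normOneUnits ι' hO := by
  ext g
  rw [Subgroup.mem_pointwise_smul_iff_inv_smul_mem, ← ConjAct.toConjAct_inv, ConjAct.toConjAct_smul, inv_inv,
    mem_normOneUnits_iff, mem_normOneUnits_iff]
  have hval : ∀ x : B, ι' x = ((h⁻¹ : GL (Fin 2) ℝ) : Matrix (Fin 2) (Fin 2) ℝ) * ι x * (h : Matrix (Fin 2) (Fin 2) ℝ) := by
    intro x
    rw [hconj x]
    calc ι' x = (((h⁻¹ : GL (Fin 2) ℝ) : Matrix (Fin 2) (Fin 2) ℝ) * (h : Matrix (Fin 2) (Fin 2) ℝ)) * ι' x *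
          (((h⁻¹ : GL (Fin 2) ℝ) : Matrix (Fin 2) (Fin 2) ℝ) * (h : Matrix (Fin 2) (Fin 2) ℝ)) := by
            rw [Units.inv_mul, one_mul, mul_one]
      _ = ((h⁻¹ : GL (Fin 2) ℝ) : Matrix (Fin 2) (Fin 2) ℝ) *
          ((h : Matrix (Fin 2) (Fin 2) ℝ) * ι' x * ((h⁻¹ : GL (Fin 2) ℝ) : Matrix (Fin 2) (Fin 2) ℝ)) * (h : Matrix (Fin 2) (Fin 2) ℝ) := by
            noncomm_ring
  have hdet : ∀ g : GL (Fin 2) ℝ, Matrix.GeneralLinearGroup.det (h⁻¹ * g * h) = Matrix.GeneralLinearGroup.det g := by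
    intro g
    rw [map_mul, map_mul, map_inv, mul_comm ((Matrix.GeneralLinearGroup.det h)⁻¹) _, mul_assoc, inv_mul_cancel, mul_one]
  constructor
  · rintro ⟨⟨x, hx, hxg⟩, ⟨y, hy, hyg⟩, hdg⟩
    refine ⟨⟨x, hx, ?_⟩, ⟨y, hy, ?_⟩, ?_⟩
    · rw [hval, hxg, ← Units.val_mul, ← Units.val_mul]
    · rw [hval, hyg, ← Units.val_mul, ← Units.val_mul]
      congr 1
      group
    · rw [hdet, hdg]
  · rintro ⟨⟨x, hx, hxg⟩, ⟨y, hy, hyg⟩, hdg⟩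
    refine ⟨⟨x, hx, ?_⟩, ⟨y, hy, ?_⟩, ?_⟩
    · rw [hconj, hxg, ← Units.val_mul, ← Units.val_mul]
      congr 1
      group
    · rw [hconj, hyg, ← Units.val_mul, ← Units.val_mul]
      congr 1
      group
    · rw [← hdet, hdg]

end Presentation

/-! ## §2 The norm-one groups of two orders are commensurable -/

section Commensurable

variable {B : Type*} [Ring B] [Algebra ℚ B] [IsQuaternionAlgebra ℚ B] (ι : B →ₐ[ℚ] Matrix (Fin 2) (Fin 2) ℝ)

/-- **Finitely many cosets for ANY two orders `O₁`, `O₃`**: there is a finite set of norm-one units `t_v ∈ ι(O₁¹)` such that every element of `ι(O₁¹)` lies in some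
`t_v · ι(O₃¹)` (coordinates modulo `N` in a `ℤ`-basis of `O₁`, where `N·O₁ ⊆ O₃` — such `N` exists for any two full lattices; no nesting is needed).
-- adapted from Summits/…/ClassRecordThreeEulerHalvesAtThreeCartanCoverCocompact.lean `exists_finset_leftCosets` (g27: the case `X.O ≤ X.O₀`)
[cite: VignerasLNM800, Ch. I §4 and Ch. IV §1 Thm. 1.1] -/
theorem exists_finset_leftCosets (hι : Function.Injective ι) {O₁ O₃ : Submodule ℤ B} (h₁ : Brandt.IsOrder B O₁)
    (h₃ : Brandt.IsOrder B O₃) :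
    ∃ T : Finset (GL (Fin 2) ℝ), (∀ t ∈ T, t ∈ normOneUnits ι h₁) ∧
      ∀ γ ∈ normOneUnits ι h₁, ∃ t ∈ T, t⁻¹ * γ ∈ normOneUnits ι h₃ := by
  classical
  -- `N • O₁ ⊆ O₃`
  obtain ⟨n, hn0, hn⟩ := exists_smul_mem_of_fg h₃.isFullLattice h₁.isFullLattice.1
  set N : ℕ := n.natAbs with hNdef
  have hN : N ≠ 0 := Int.natAbs_ne_zero.mpr hn0
  haveI : NeZero N := ⟨hN⟩
  have hNmem : ∀ a ∈ O₁, ((N : ℕ) : ℤ) • a ∈ O₃ := by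
    intro a ha
    rcases Int.natAbs_eq n with h | h
    · rw [hNdef, ← h]; exact hn a ha
    · have : ((n.natAbs : ℕ) : ℤ) • a = -(n • a) := by
        rw [← neg_smul]
        congr 1
        omega
      rw [hNdef, this]; exact O₃.neg_mem (hn a ha)
  -- a `ℤ`-basis of `O₁` and coordinates modulo `N`
  obtain ⟨b⟩ := h₁.isFullLattice.nonempty_basis_fin_four
  let coord : O₁ → (Fin 4 → ZMod N) := fun x i => ((b.repr x i : ℤ) : ZMod N)
  have hcoord : ∀ x y : O₁, coord x = coord y → ∃ z : O₁, (x : B) - y = (N : ℤ) • (z : B) := by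
    intro x y hxy
    have hdiv : ∀ i, (N : ℤ) ∣ b.repr x i - b.repr y i := by
      intro i
      have h := congr_fun hxy i
      exact (ZMod.intCast_eq_intCast_iff_dvd_sub _ _ _).mp h.symm
    choose c hc using hdiv
    refine ⟨Finsupp.linearCombination ℤ b (Finsupp.equivFunOnFinite.symm c), ?_⟩
    have hrepr : b.repr (x - y) = (N : ℤ) • Finsupp.equivFunOnFinite.symm c := by
      ext i
      simp [hc i]
    have hxmy : x - y = (N : ℤ) • Finsupp.linearCombination ℤ b (Finsupp.equivFunOnFinite.symm c) := by
      apply b.repr.injective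
      rw [hrepr, map_zsmul, b.repr_linearCombination]
    have := congrArg (fun v : O₁ => (v : B)) hxmy
    simpa using this
  -- lifts of units to `O₁`
  have hlift : ∀ γ ∈ normOneUnits ι h₁, ∃ u : O₁, ι (u : B) = (γ : Matrix (Fin 2) (Fin 2) ℝ) := by
    rintro γ ⟨⟨x, hx, hxγ⟩, -, -⟩
    exact ⟨⟨x, hx⟩, hxγ⟩
  choose! lift hliftι using hlift
  have hfin : (Set.range fun γ : normOneUnits ι h₁ => coord (lift γ)).Finite := Set.toFinite _
  have hrep : ∀ v ∈ Set.range (fun γ : normOneUnits ι h₁ => coord (lift γ)),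
      ∃ t : GL (Fin 2) ℝ, t ∈ normOneUnits ι h₁ ∧ coord (lift t) = v := by
    rintro v ⟨γ, rfl⟩
    exact ⟨γ, γ.2, rfl⟩
  choose! rep hrepmem hrepcoord using hrep
  refine ⟨hfin.toFinset.image rep, ?_, ?_⟩
  · intro t ht
    obtain ⟨v, hv, rfl⟩ := Finset.mem_image.mp ht
    exact hrepmem v (hfin.mem_toFinset.mp hv)
  · intro γ hγ
    set v := coord (lift γ) with hvdef
    have hv : v ∈ Set.range (fun γ : normOneUnits ι h₁ => coord (lift γ)) := ⟨⟨γ, hγ⟩, rfl⟩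
    refine ⟨rep v, Finset.mem_image.mpr ⟨v, hfin.mem_toFinset.mpr hv, rfl⟩, ?_⟩
    have ht := hrepmem v hv
    have hc : coord (lift (rep v)) = coord (lift γ) := by rw [hrepcoord v hv]
    obtain ⟨z, hz⟩ := hcoord _ _ hc
    obtain ⟨⟨xt, hxt, hxtι⟩, ⟨yt, hyt, hytι⟩, hdet_t⟩ := ht
    obtain ⟨⟨xγ, hxγ, hxγι⟩, ⟨yγ, hyγ, hyγι⟩, hdet_γ⟩ := hγ
    have hut : (lift (rep v) : B) = xt := hι (by rw [hliftι _ ⟨⟨xt, hxt, hxtι⟩, ⟨yt, hyt, hytι⟩, hdet_t⟩, hxtι])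
    have huγ : (lift γ : B) = xγ := hι (by rw [hliftι _ ⟨⟨xγ, hxγ, hxγι⟩, ⟨yγ, hyγ, hyγι⟩, hdet_γ⟩, hxγι])
    have hyx : yt * xt = 1 := hι (by rw [map_mul, hytι, hxtι, ← Units.val_mul, inv_mul_cancel, Units.val_one, map_one])
    have hmemO : yt * xγ ∈ O₃ := by
      have e : yt * xγ = 1 + (-(yt * ((N : ℤ) • (z : B)))) := by
        have : (xt : B) - xγ = (N : ℤ) • (z : B) := by rw [← hut, ← huγ]; exact hz
        calc yt * xγ = yt * xt - yt * (xt - xγ) := by noncomm_ring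
          _ = 1 + (-(yt * ((N : ℤ) • (z : B)))) := by rw [hyx, this]; abel
      rw [e]
      refine O₃.add_mem h₃.one_mem (O₃.neg_mem ?_)
      rw [mul_smul_comm]
      exact hNmem _ (h₁.mul_mem yt hyt _ z.2)
    have hmemO' : yγ * xt ∈ O₃ := by
      have hyγx : yγ * xγ = 1 := hι (by rw [map_mul, hyγι, hxγι, ← Units.val_mul, inv_mul_cancel, Units.val_one, map_one])
      have e : yγ * xt = 1 + yγ * ((N : ℤ) • (z : B)) := by
        have : (xt : B) - xγ = (N : ℤ) • (z : B) := by rw [← hut, ← huγ]; exact hz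
        calc yγ * xt = yγ * xγ + yγ * (xt - xγ) := by noncomm_ring
          _ = 1 + yγ * ((N : ℤ) • (z : B)) := by rw [hyγx, this]
      rw [e]
      refine O₃.add_mem h₃.one_mem ?_
      rw [mul_smul_comm]
      exact hNmem _ (h₁.mul_mem yγ hyγ _ z.2)
    refine ⟨⟨yt * xγ, hmemO, by rw [map_mul, hytι, hxγι, Units.val_mul]⟩, ⟨yγ * xt, hmemO', ?_⟩, ?_⟩
    · rw [map_mul, hyγι, hxtι, mul_inv_rev, inv_inv, Units.val_mul]
    · rw [map_mul, map_inv, hdet_t, hdet_γ, inv_one, one_mul]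

/-- **`ι(O₁¹) ∩ ι(O₃¹)` has finite index in `ι(O₁¹)` for ANY two orders `O₁`, `O₃`.** [cite: VignerasLNM800, Ch. I §4] -/
theorem finiteIndex_normOneUnits_subgroupOf (hι : Function.Injective ι) {O₁ O₃ : Submodule ℤ B} (h₁ : Brandt.IsOrder B O₁)
    (h₃ : Brandt.IsOrder B O₃) : ((normOneUnits ι h₃).subgroupOf (normOneUnits ι h₁)).FiniteIndex := by
  classical
  obtain ⟨T, hT, hcos⟩ := exists_finset_leftCosets ι hι h₁ h₃
  let f : T → normOneUnits ι h₁ ⧸ (normOneUnits ι h₃).subgroupOf (normOneUnits ι h₁) :=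
    fun t => QuotientGroup.mk ⟨(t : GL (Fin 2) ℝ), hT t t.2⟩
  have hf : Function.Surjective f := by
    intro q
    induction q using QuotientGroup.induction_on with
    | H γ =>
      obtain ⟨t, ht, htγ⟩ := hcos γ γ.2
      refine ⟨⟨t, ht⟩, ?_⟩
      refine QuotientGroup.eq.mpr ?_
      rw [Subgroup.mem_subgroupOf]
      simpa using htγ
  haveI : Finite (normOneUnits ι h₁ ⧸ (normOneUnits ι h₃).subgroupOf (normOneUnits ι h₁)) := Finite.of_surjective f hf
  exact Subgroup.finiteIndex_of_finite_quotient

/-- **THE NORM-ONE GROUPS OF ANY TWO ORDERS OF A QUATERNION ALGEBRA ARE COMMENSURABLE** (`ι(O₁¹) ∩ ι(O₂¹)` has finite index in both).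
[cite: VignerasLNM800, Ch. I §4 and Ch. IV §1 Thm. 1.1] [cite: Bergeron2016, §2.2 p. 36] -/
theorem commensurable_normOneUnits (hι : Function.Injective ι) {O₁ O₂ : Submodule ℤ B} (h₁ : Brandt.IsOrder B O₁) (h₂ : Brandt.IsOrder B O₂) :
    Subgroup.Commensurable (normOneUnits ι h₁) (normOneUnits ι h₂) :=
  ⟨(finiteIndex_normOneUnits_subgroupOf ι hι h₂ h₁).index_ne_zero, (finiteIndex_normOneUnits_subgroupOf ι hι h₁ h₂).index_ne_zero⟩

end Commensurable

end Summit.BirchSwinnertonDyer.BirchSwinnertonDyer.Theorems.CartanCover.PrintClauses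

end
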